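import Summits.HodgeConjecture.HodgeConjecture.Theorems.HLiu418E2ArchOrthHol
import Mathlib.Analysis.Complex.Schwarz
import HarnessLib

/-!
# Crux `HLiu418`, K-lane E₂ — S3₂ prerequisites: a UNIFORM modulus of continuity of cone-holomorphic cotangent forms along the
# archimedean factor at `w₁` (slice coordinates of `u ∈ U`, the cone law, the boost bound and the Schwarz lemma)

Cell `hodgecm-mathlib`, FLOOR 0, programme P5 (`F0_AlbCm`); crux item `stmt-HodgeConjecture-24832`; seat F0P5-p02 (g2),
`--supports stmt-HodgeConjecture-24832` (helper).  THEOREMS ONLY — no definition, no instance, no notation, no `sorry`.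

For a cone frame `𝔣` with `⟪v₀,t₀⟫ = 0`, `⟪v₀,v₀⟫ = −r⟪t₀,t₀⟫` and `f ∈ holCotForms₂ … 𝔣` with `|f| ≤ C`:
* §1 `apply_eq_modulus_mul_slice` — for `u ∈ U` with frame coordinates `u v₀ = P t₀ + Q v₀`, `u t₀ = p′ t₀ + q′ v₀` and `z = P/Q`: the cone-law
  extension `Φ_x` of the slice at `x` satisfies `Φ_x(u) = m · Φ_x(s(z))`, `m = (p′ − q′ z)/Q`, `s(z) = 1 + zN` (cone law at `g = s(z)`,
  `b = s(−z) u`; NO boost is needed);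
* §2 `norm_apply_slice_le` — `|Φ_x(s(z))| ≤ C · r/(r − |z|²)` (★ `apply_slice_eq`: the boost absorbs the slice), and by the Schwarz lemma
  (Mathlib `Complex.dist_le_div_mul_dist_of_mapsTo_ball`) `|Φ_x(s(z)) − Φ_x(1)| ≤ (8C/√(r/2)) |z|` on `|z| < √(r/2)`;
* §3 `eventually_norm_sub_le` — THE UNIFORM MODULUS: for every `ε > 0`, for all `u` near `1` in `U`, EVERY `f ∈ holCotForms₂ … 𝔣` with `|f| ≤ C`
  and EVERY adelic `x` satisfy `|f(x · ι u) − f(x)| ≤ ε` (`m → 1`, `z → 0` are explicit rational functions of the entries of `u`).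
Consumed by ★-candidate `Theorems/HLiu418E2LevelFinite` (equicontinuity ⇒ Arzelà–Ascoli ⇒ finite-dimensionality of level-`K` cone forms ⇒
S3₂ `AdmissibleOfHolValuedType₂`).  HONEST LABEL: HC_CM is proved only modulo the 7 printed citations until rung 0 closes; this file
discharges none of them.

## References
* [Borel1997] A. Borel, *Automorphic forms on SL₂(ℝ)* (1997), §5.13–§5.14, §8 (finite dimensionality via compactness).
* [AhlforsCA1979] L. Ahlfors, *Complex Analysis*, Ch. 4 §3.4 (Schwarz lemma / Cauchy estimate).
-/

set_option autoImplicit false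
-- the mandated namespace has the single-problem summit's repeated segment (`HodgeConjecture.HodgeConjecture`)
set_option linter.dupNamespace false

noncomputable section

open Matrix MeasureTheory NumberField NumberField.InfinitePlace Metric Filter Topology
open scoped Matrix ComplexConjugate ComplexOrder
open Literature.NumberTheory.Automorphic Literature.NumberTheory.Automorphic.UnitaryGroup
open Literature.NumberTheory.Automorphic.UnitaryCurveForms
open Literature.AlgebraicGeometry.ShimuraVarieties Literature.AlgebraicGeometry.ShimuraVarieties.UnitaryCurveCone
open Summit.HodgeConjecture.HodgeConjecture.Cruxes.HLiu418.E2DiscSlice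
open Summit.HodgeConjecture.HodgeConjecture.Cruxes.HLiu418.E2DiscBoost
open Summit.HodgeConjecture.HodgeConjecture.Cruxes.HLiu418.E2ArchOrthHolPrep
open Summit.HodgeConjecture.HodgeConjecture.Cruxes.HLiu418.E2ArchOrthHol

namespace Summit.HodgeConjecture.HodgeConjecture.Cruxes.HLiu418.E2SliceModulus

variable {F E : Type} [Field F] [NumberField F] [Field E] [NumberField E] [Algebra F E]
  {c : E ≃ₐ[F] E} {J : Matrix (Fin 2) (Fin 2) E}
  {hc : c ≠ 1} {hfix : ∀ w : InfinitePlace E, c • w = w} {w₁ : {w : InfinitePlace E // IsComplex w}} {𝔣 : ConeFrame E J w₁}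

/-! ## §1 The cone law in slice coordinates (no boost) -/

omit [NumberField E] in
/-- **`Φ(u) = m · Φ(s(z))`.**  For a cone-law function `Φ` (★ `IsConeHol`), the nilpotent `N` of the frame, and a matrix `M` with frame
coordinates `M v₀ = P t₀ + Q v₀` (`Q ≠ 0`, `|P/Q|² < r`), `M t₀ = p′ t₀ + q′ v₀`: `Φ M = ((p′ − q′ (P/Q)) Q⁻¹) · Φ (1 + (P/Q) N)` — the cone
law at `g = s(P/Q)`, `b = s(−P/Q) M` (`b v₀ = Q v₀`, `b t₀ = (p′ − q′ P/Q) t₀ + q′ v₀`). [cite: Borel1997, §5.13–§5.14] -/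
theorem apply_eq_modulus_mul_slice (hvt : star 𝔣.v₀ ⬝ᵥ (J.map w₁.1.embedding *ᵥ 𝔣.t₀) = 0) {r : ℝ}
    (hvv : star 𝔣.v₀ ⬝ᵥ (J.map w₁.1.embedding *ᵥ 𝔣.v₀) = -(r : ℂ) * (star 𝔣.t₀ ⬝ᵥ (J.map w₁.1.embedding *ᵥ 𝔣.t₀)))
    {Φ : Matrix (Fin 2) (Fin 2) ℂ → ℂ} (hΦ : IsConeHol 𝔣 Φ) {N : Matrix (Fin 2) (Fin 2) ℂ} (hNv : N *ᵥ 𝔣.v₀ = 𝔣.t₀) (hNt : N *ᵥ 𝔣.t₀ = 0)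
    (hNN : N * N = 0) {M : Matrix (Fin 2) (Fin 2) ℂ} {P Q p' q' : ℂ} (hMv : M *ᵥ 𝔣.v₀ = P • 𝔣.t₀ + Q • 𝔣.v₀)
    (hMt : M *ᵥ 𝔣.t₀ = p' • 𝔣.t₀ + q' • 𝔣.v₀) (hQ : Q ≠ 0) (hz : ‖P / Q‖ ^ 2 < r) :
    Φ M = ((p' - q' * (P / Q)) * Q⁻¹) * Φ (1 + (P / Q) • N) := by
  obtain ⟨hsv, hst, hss', hs's⟩ := slice_props 𝔣 hNv hNt hNN (P / Q)
  -- `M = s(z) · (s(-z) M)`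
  have hfac : M = (1 + (P / Q) • N) * ((1 + (-(P / Q)) • N) * M) := by rw [← Matrix.mul_assoc, hss', Matrix.one_mul]
  obtain ⟨hs'v, hs't, -, -⟩ := slice_props 𝔣 hNv hNt hNN (-(P / Q))
  have hbv : ((1 + (-(P / Q)) • N) * M) *ᵥ 𝔣.v₀ = Q • 𝔣.v₀ := by
    rw [← mulVec_mulVec, hMv, mulVec_add, mulVec_smul, mulVec_smul, hs't, hs'v]
    have : P • 𝔣.t₀ + Q • (𝔣.v₀ + (-(P / Q)) • 𝔣.t₀) = (P - Q * (P / Q)) • 𝔣.t₀ + Q • 𝔣.v₀ := by module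
    rw [this, mul_div_cancel₀ _ hQ, sub_self, zero_smul, zero_add]
  have hbt : ((1 + (-(P / Q)) • N) * M) *ᵥ 𝔣.t₀ = (p' - q' * (P / Q)) • 𝔣.t₀ + q' • 𝔣.v₀ := by
    rw [← mulVec_mulVec, hMt, mulVec_add, mulVec_smul, mulVec_smul, hs't, hs'v]
    module
  have hg : (1 + (P / Q) • N) *ᵥ 𝔣.v₀ ∈ negCone (J.map w₁.1.embedding) := by
    rw [hsv]; exact (v₀_add_smul_t₀_mem_negCone_iff 𝔣 hvt hvv _).2 hz
  conv_lhs => rw [hfac]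
  exact hΦ.2 _ _ _ _ _ (isUnit_slice 𝔣 hNv hNt hNN _) hg hQ hbv hbt

/-! ## §2 The boost bound and the Schwarz estimate along the slice -/

section Bounds

variable {μ : Measure (adelicGroupData F E c 2 J).automorphicQuotient}

/-- **`|Φ_x(s(z))| ≤ C · r/(r − |z|²)`**: the boost absorbs the slice (★ `apply_slice_eq`) and `|f| ≤ C`. [cite: Borel1997, §5.13–§5.14] -/
theorem norm_apply_slice_le (hvt : star 𝔣.v₀ ⬝ᵥ (J.map w₁.1.embedding *ᵥ 𝔣.t₀) = 0) {r : ℝ} (hr : 0 < r)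
    (hvv : star 𝔣.v₀ ⬝ᵥ (J.map w₁.1.embedding *ᵥ 𝔣.v₀) = -(r : ℂ) * (star 𝔣.t₀ ⬝ᵥ (J.map w₁.1.embedding *ᵥ 𝔣.t₀)))
    {f : (adelicGroupData F E c 2 J).Adelic → ℂ} {C : ℝ} (hC : ∀ y, ‖f y‖ ≤ C) (x : (adelicGroupData F E c 2 J).Adelic)
    {Φ : Matrix (Fin 2) (Fin 2) ℂ → ℂ}
    (hΦf : ∀ u : archLocal E 2 J w₁, Φ ((u : GL (Fin 2) ℂ) : Matrix (Fin 2) (Fin 2) ℂ) = f (x * adelicSingle F E c 2 J hc hfix w₁ u))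
    (hΦ : IsConeHol 𝔣 Φ) {N : Matrix (Fin 2) (Fin 2) ℂ} (hNv : N *ᵥ 𝔣.v₀ = 𝔣.t₀) (hNt : N *ᵥ 𝔣.t₀ = 0) {z : ℂ} (hz : ‖z‖ ^ 2 < r) :
    ‖Φ (1 + z • N)‖ ≤ r / (r - ‖z‖ ^ 2) * C := by
  obtain ⟨hν, hν2⟩ := boostParam_pos_and_sq hr hz
  obtain ⟨u, -, -, hu't, hu'v⟩ := exists_boost 𝔣 hvt hr hvv hν hν2
  rw [apply_slice_eq x hΦ hΦf hNv hNt hr hν hν2 hu't hu'v, norm_mul, boostMultiplier_eq hr hz, Complex.norm_real,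
    Real.norm_of_nonneg (div_pos hr (sub_pos.2 hz)).le]
  exact mul_le_mul_of_nonneg_left (hC _) (div_pos hr (sub_pos.2 hz)).le

/-- On the half disc `|z|² < r/2` the boost bound is `≤ 2C`. [cite: Borel1997, §5.13–§5.14] -/
theorem norm_apply_slice_le_two_mul (hvt : star 𝔣.v₀ ⬝ᵥ (J.map w₁.1.embedding *ᵥ 𝔣.t₀) = 0) {r : ℝ} (hr : 0 < r)
    (hvv : star 𝔣.v₀ ⬝ᵥ (J.map w₁.1.embedding *ᵥ 𝔣.v₀) = -(r : ℂ) * (star 𝔣.t₀ ⬝ᵥ (J.map w₁.1.embedding *ᵥ 𝔣.t₀)))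
    {f : (adelicGroupData F E c 2 J).Adelic → ℂ} {C : ℝ} (hC : ∀ y, ‖f y‖ ≤ C) (x : (adelicGroupData F E c 2 J).Adelic)
    {Φ : Matrix (Fin 2) (Fin 2) ℂ → ℂ}
    (hΦf : ∀ u : archLocal E 2 J w₁, Φ ((u : GL (Fin 2) ℂ) : Matrix (Fin 2) (Fin 2) ℂ) = f (x * adelicSingle F E c 2 J hc hfix w₁ u))
    (hΦ : IsConeHol 𝔣 Φ) {N : Matrix (Fin 2) (Fin 2) ℂ} (hNv : N *ᵥ 𝔣.v₀ = 𝔣.t₀) (hNt : N *ᵥ 𝔣.t₀ = 0) {z : ℂ} (hz : ‖z‖ ^ 2 < r / 2) :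
    ‖Φ (1 + z • N)‖ ≤ 2 * C := by
  have hC0 : 0 ≤ C := le_trans (norm_nonneg _) (hC 1)
  have hz' : ‖z‖ ^ 2 < r := by linarith
  refine (norm_apply_slice_le hvt hr hvv hC x hΦf hΦ hNv hNt hz').trans (mul_le_mul_of_nonneg_right ?_ hC0)
  rw [div_le_iff₀ (sub_pos.2 hz')]
  linarith

/-- **Schwarz estimate along the slice**: `|Φ_x(s(z)) − Φ_x(1)| ≤ (4C/√(r/2)) · 2 · |z|`-type bound — precisely
`dist (Φ (1 + z N)) (Φ 1) ≤ (4 C) / √(r/2) * ‖z‖` for `|z| < √(r/2)` (the slice function is holomorphic on the disc and maps it into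
`closedBall (Φ 1) (4C)`). [cite: AhlforsCA1979, Ch. 4 §3.4] -/
theorem dist_apply_slice_le (hvt : star 𝔣.v₀ ⬝ᵥ (J.map w₁.1.embedding *ᵥ 𝔣.t₀) = 0) {r : ℝ} (hr : 0 < r)
    (hvv : star 𝔣.v₀ ⬝ᵥ (J.map w₁.1.embedding *ᵥ 𝔣.v₀) = -(r : ℂ) * (star 𝔣.t₀ ⬝ᵥ (J.map w₁.1.embedding *ᵥ 𝔣.t₀)))
    {f : (adelicGroupData F E c 2 J).Adelic → ℂ} {C : ℝ} (hC : ∀ y, ‖f y‖ ≤ C) (x : (adelicGroupData F E c 2 J).Adelic)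
    {Φ : Matrix (Fin 2) (Fin 2) ℂ → ℂ}
    (hΦf : ∀ u : archLocal E 2 J w₁, Φ ((u : GL (Fin 2) ℂ) : Matrix (Fin 2) (Fin 2) ℂ) = f (x * adelicSingle F E c 2 J hc hfix w₁ u))
    (hΦ : IsConeHol 𝔣 Φ) {N : Matrix (Fin 2) (Fin 2) ℂ} (hNv : N *ᵥ 𝔣.v₀ = 𝔣.t₀) (hNt : N *ᵥ 𝔣.t₀ = 0) (hNN : N * N = 0)
    {z : ℂ} (hz : ‖z‖ < Real.sqrt (r / 2)) :
    dist (Φ (1 + z • N)) (Φ 1) ≤ (4 * C) / Real.sqrt (r / 2) * ‖z‖ := by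
  have hC0 : 0 ≤ C := le_trans (norm_nonneg _) (hC 1)
  have hr2 : 0 < r / 2 := by positivity
  -- the slice function on the disc `|z| < √(r/2)`
  let Of : Fin 2 → Fin 2 → ℂ := (1 : Matrix (Fin 2) (Fin 2) ℂ)
  let Nf : Fin 2 → Fin 2 → ℂ := N
  have hsl : Differentiable ℂ (fun z : ℂ => Of + z • Nf) := (differentiable_id.smul_const Nf).const_add Of
  have hslN : ∀ z : ℂ, Matrix.of (Of + z • Nf) = 1 + z • N := fun _ => rfl
  have hsq : ∀ y : ℂ, y ∈ ball (0 : ℂ) (Real.sqrt (r / 2)) → ‖y‖ ^ 2 < r / 2 := fun y hy => by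
    rw [mem_ball, dist_zero_right] at hy
    exact (Real.lt_sqrt (norm_nonneg y)).1 hy
  have hmaps : Set.MapsTo (fun z : ℂ => Of + z • Nf) (ball (0 : ℂ) (Real.sqrt (r / 2)))
      {g | IsUnit (Matrix.of g) ∧ Matrix.of g *ᵥ 𝔣.v₀ ∈ negCone (J.map w₁.1.embedding)} := by
    intro y hy
    rw [Set.mem_setOf_eq, hslN, (slice_props 𝔣 hNv hNt hNN y).1]
    exact ⟨isUnit_slice 𝔣 hNv hNt hNN y, (v₀_add_smul_t₀_mem_negCone_iff 𝔣 hvt hvv y).2 (by linarith [hsq y hy])⟩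
  have hdiff : DifferentiableOn ℂ (fun y : ℂ => Φ (1 + y • N)) (ball (0 : ℂ) (Real.sqrt (r / 2))) := by
    have h := hΦ.1.comp hsl.differentiableOn hmaps
    refine h.congr fun y _ => ?_
    rw [Function.comp_apply, hslN]
  have hmt : Set.MapsTo (fun y : ℂ => Φ (1 + y • N)) (ball (0 : ℂ) (Real.sqrt (r / 2))) (closedBall (Φ (1 + (0 : ℂ) • N)) (4 * C)) := by
    intro y hy
    rw [mem_closedBall, dist_eq_norm]
    have h1 := norm_apply_slice_le_two_mul hvt hr hvv hC x hΦf hΦ hNv hNt (hsq y hy)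
    have h2 := norm_apply_slice_le_two_mul hvt hr hvv hC x hΦf hΦ hNv hNt (z := 0) (by rw [norm_zero]; simpa using hr2)
    calc ‖Φ (1 + y • N) - Φ (1 + (0 : ℂ) • N)‖ ≤ ‖Φ (1 + y • N)‖ + ‖Φ (1 + (0 : ℂ) • N)‖ := norm_sub_le _ _
      _ ≤ 2 * C + 2 * C := add_le_add h1 h2
      _ = 4 * C := by ring
  have hzb : z ∈ ball (0 : ℂ) (Real.sqrt (r / 2)) := by rwa [mem_ball, dist_zero_right]
  have h := Complex.dist_le_div_mul_dist_of_mapsTo_ball hdiff hmt hzb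
  rw [zero_smul, add_zero, dist_zero_right] at h
  exact h

end Bounds

/-! ## §3 The uniform modulus of continuity along `U` -/

section Modulus

/-- **THE UNIFORM MODULUS.**  For every `ε > 0`: for all `u` in a neighbourhood of `1` in `U = U(σ_{w₁}J)(ℂ)`, every cone-holomorphic
cotangent form `f ∈ holCotForms₂ … 𝔣` with `|f| ≤ C` and every adelic `x` satisfy `|f(x · ι u) − f(x)| ≤ ε`.  (Slice coordinates
`z(u) → 0`, `m(u) → 1` are rational functions of the entries of `u`; `f(x ι u) = m(u) Φ_x(s(z(u)))`, `f(x) = Φ_x(1)`, and §2.)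
[cite: Borel1997, §5.13–§5.14 and §8] [cite: AhlforsCA1979, Ch. 4 §3.4] -/
theorem eventually_norm_sub_le (hvt : star 𝔣.v₀ ⬝ᵥ (J.map w₁.1.embedding *ᵥ 𝔣.t₀) = 0) {r : ℝ} (hr : 0 < r)
    (hvv : star 𝔣.v₀ ⬝ᵥ (J.map w₁.1.embedding *ᵥ 𝔣.v₀) = -(r : ℂ) * (star 𝔣.t₀ ⬝ᵥ (J.map w₁.1.embedding *ᵥ 𝔣.t₀)))
    (C : ℝ) {ε : ℝ} (hε : 0 < ε) :
    ∀ᶠ u in 𝓝 (1 : archLocal E 2 J w₁), ∀ f : (adelicGroupData F E c 2 J).Adelic → ℂ,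
      f ∈ holCotForms₂ F E c J hc hfix w₁ 𝔣 → (∀ y, ‖f y‖ ≤ C) →
      ∀ x : (adelicGroupData F E c 2 J).Adelic, ‖f (x * adelicSingle F E c 2 J hc hfix w₁ u) - f x‖ ≤ ε := by
  obtain ⟨N, hNv, hNt, hNN⟩ := exists_nilpotent 𝔣 hvt
  have hT := form_t₀_ne_zero 𝔣
  have hV := form_v₀_ne_zero 𝔣
  -- the frame coordinates of `u v₀`, `u t₀` as continuous functions of `u`
  let uM : archLocal E 2 J w₁ → Matrix (Fin 2) (Fin 2) ℂ := fun u => ((u : GL (Fin 2) ℂ) : Matrix (Fin 2) (Fin 2) ℂ)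
  have huM : Continuous uM := Units.continuous_val.comp continuous_subtype_val
  let Pc : archLocal E 2 J w₁ → ℂ := fun u =>
    (star 𝔣.t₀ ⬝ᵥ (J.map w₁.1.embedding *ᵥ (uM u *ᵥ 𝔣.v₀))) * (star 𝔣.t₀ ⬝ᵥ (J.map w₁.1.embedding *ᵥ 𝔣.t₀))⁻¹
  let Qc : archLocal E 2 J w₁ → ℂ := fun u =>
    (star 𝔣.v₀ ⬝ᵥ (J.map w₁.1.embedding *ᵥ (uM u *ᵥ 𝔣.v₀))) * (star 𝔣.v₀ ⬝ᵥ (J.map w₁.1.embedding *ᵥ 𝔣.v₀))⁻¹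
  let pc : archLocal E 2 J w₁ → ℂ := fun u =>
    (star 𝔣.t₀ ⬝ᵥ (J.map w₁.1.embedding *ᵥ (uM u *ᵥ 𝔣.t₀))) * (star 𝔣.t₀ ⬝ᵥ (J.map w₁.1.embedding *ᵥ 𝔣.t₀))⁻¹
  let qc : archLocal E 2 J w₁ → ℂ := fun u =>
    (star 𝔣.v₀ ⬝ᵥ (J.map w₁.1.embedding *ᵥ (uM u *ᵥ 𝔣.t₀))) * (star 𝔣.v₀ ⬝ᵥ (J.map w₁.1.embedding *ᵥ 𝔣.v₀))⁻¹
  have hdec_v : ∀ u, uM u *ᵥ 𝔣.v₀ = Pc u • 𝔣.t₀ + Qc u • 𝔣.v₀ := fun u => frame_decomp 𝔣 hvt _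
  have hdec_t : ∀ u, uM u *ᵥ 𝔣.t₀ = pc u • 𝔣.t₀ + qc u • 𝔣.v₀ := fun u => frame_decomp 𝔣 hvt _
  -- continuity of the coordinates
  have hcoord : ∀ a b : Fin 2 → ℂ, Continuous fun u : archLocal E 2 J w₁ => star a ⬝ᵥ (J.map w₁.1.embedding *ᵥ (uM u *ᵥ b)) :=
    fun a b => continuous_const.dotProduct (continuous_const.matrix_mulVec (huM.matrix_mulVec continuous_const))
  have hPc : Continuous Pc := (hcoord _ _).mul continuous_const
  have hQc : Continuous Qc := (hcoord _ _).mul continuous_const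
  have hpc : Continuous pc := (hcoord _ _).mul continuous_const
  have hqc : Continuous qc := (hcoord _ _).mul continuous_const
  -- values at `1`
  have huM1 : uM 1 = 1 := rfl
  have hP1 : Pc 1 = 0 := by simp only [Pc, huM1, one_mulVec, 𝔣.orth, zero_mul]
  have hQ1 : Qc 1 = 1 := by simp only [Qc, huM1, one_mulVec]; exact mul_inv_cancel₀ hV
  have hp1 : pc 1 = 1 := by simp only [pc, huM1, one_mulVec]; exact mul_inv_cancel₀ hT
  have hq1 : qc 1 = 0 := by simp only [qc, huM1, one_mulVec, hvt, zero_mul]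
  -- `z(u) → 0`, `m(u) → 1`
  let zc : archLocal E 2 J w₁ → ℂ := fun u => Pc u / Qc u
  let mc : archLocal E 2 J w₁ → ℂ := fun u => (pc u - qc u * zc u) * (Qc u)⁻¹
  have hz0 : Tendsto zc (𝓝 1) (𝓝 0) := by
    have h : Tendsto (fun u => Pc u / Qc u) (𝓝 1) (𝓝 (Pc 1 / Qc 1)) :=
      (hPc.tendsto 1).div (hQc.tendsto 1) (by rw [hQ1]; exact one_ne_zero)
    rw [hP1, zero_div] at h
    exact h
  have hm1 : Tendsto mc (𝓝 1) (𝓝 1) := by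
    have h : Tendsto (fun u => (pc u - qc u * zc u) * (Qc u)⁻¹) (𝓝 1) (𝓝 ((pc 1 - qc 1 * 0) * (Qc 1)⁻¹)) :=
      (((hpc.tendsto 1).sub ((hqc.tendsto 1).mul hz0)).mul ((hQc.tendsto 1).inv₀ (by rw [hQ1]; exact one_ne_zero)))
    rw [hp1, hq1, hQ1, zero_mul, sub_zero, inv_one, mul_one] at h
    exact h
  -- the bound `B(u) = |m − 1| · 2C + (4C/√(r/2)) |z| → 0`
  have hC0 : 0 ≤ max C 0 := le_max_right _ _
  have hB : Tendsto (fun u => ‖mc u - 1‖ * (2 * max C 0) + (4 * max C 0) / Real.sqrt (r / 2) * ‖zc u‖) (𝓝 1) (𝓝 0) := by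
    have h1 : Tendsto (fun u => ‖mc u - 1‖) (𝓝 1) (𝓝 0) := by
      have := (hm1.sub_const 1).norm
      rwa [sub_self, norm_zero] at this
    have h2 : Tendsto (fun u => ‖zc u‖) (𝓝 1) (𝓝 0) := by
      have := hz0.norm
      rwa [norm_zero] at this
    have := (h1.mul_const (2 * max C 0)).add (h2.const_mul ((4 * max C 0) / Real.sqrt (r / 2)))
    rwa [zero_mul, mul_zero, add_zero] at this
  have hr2 : 0 < Real.sqrt (r / 2) := Real.sqrt_pos.2 (by positivity)
  -- eventually: `Q(u) ≠ 0`, `|z(u)| < √(r/2)`, `B(u) < ε`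
  have hevQ : ∀ᶠ u in 𝓝 (1 : archLocal E 2 J w₁), Qc u ≠ 0 :=
    (hQc.continuousAt (x := 1)).eventually_ne (by rw [hQ1]; exact one_ne_zero)
  have hevz : ∀ᶠ u in 𝓝 (1 : archLocal E 2 J w₁), ‖zc u‖ < Real.sqrt (r / 2) := by
    have := hz0.norm
    rw [norm_zero] at this
    exact this.eventually (gt_mem_nhds hr2)
  have hevB : ∀ᶠ u in 𝓝 (1 : archLocal E 2 J w₁), ‖mc u - 1‖ * (2 * max C 0) + (4 * max C 0) / Real.sqrt (r / 2) * ‖zc u‖ < ε :=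
    hB.eventually (gt_mem_nhds hε)
  filter_upwards [hevQ, hevz, hevB] with u huQ huz huB f hf hfC x
  -- the form at level `C' = max C 0`
  have hfC' : ∀ y, ‖f y‖ ≤ max C 0 := fun y => (hfC y).trans (le_max_left _ _)
  obtain ⟨Φ, hΦ, hΦf⟩ := ((mem_holCotForms₂_iff F E c J hc hfix w₁ 𝔣 f).1 hf).2.2.2 x
  have hzr : ‖zc u‖ ^ 2 < r := by
    have := (Real.lt_sqrt (norm_nonneg _)).1 huz
    linarith
  have h1 : f (x * adelicSingle F E c 2 J hc hfix w₁ u) = mc u * Φ (1 + zc u • N) := by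
    rw [← hΦf u]
    exact apply_eq_modulus_mul_slice hvt hvv hΦ hNv hNt hNN (hdec_v u) (hdec_t u) huQ hzr
  have h2 : f x = Φ 1 := by
    have := hΦf 1
    rw [map_one, mul_one] at this
    rw [← this]
    rfl
  rw [h1, h2]
  have hsplit : mc u * Φ (1 + zc u • N) - Φ 1 = (mc u - 1) * Φ (1 + zc u • N) + (Φ (1 + zc u • N) - Φ 1) := by ring
  rw [hsplit]
  have hzr2 : ‖zc u‖ ^ 2 < r / 2 := (Real.lt_sqrt (norm_nonneg _)).1 huz
  calc ‖(mc u - 1) * Φ (1 + zc u • N) + (Φ (1 + zc u • N) - Φ 1)‖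
      ≤ ‖(mc u - 1) * Φ (1 + zc u • N)‖ + ‖Φ (1 + zc u • N) - Φ 1‖ := norm_add_le _ _
    _ ≤ ‖mc u - 1‖ * (2 * max C 0) + (4 * max C 0) / Real.sqrt (r / 2) * ‖zc u‖ := by
        refine add_le_add ?_ ?_
        · rw [norm_mul]
          exact mul_le_mul_of_nonneg_left (norm_apply_slice_le_two_mul hvt hr hvv hfC' x hΦf hΦ hNv hNt hzr2) (norm_nonneg _)
        · rw [← dist_eq_norm]
          exact dist_apply_slice_le hvt hr hvv hfC' x hΦf hΦ hNv hNt hNN huz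
    _ ≤ ε := huB.le

end Modulus

end Summit.HodgeConjecture.HodgeConjecture.Cruxes.HLiu418.E2SliceModulus

end
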